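import Literature.NumberTheory.ComplexMultiplication.FiniteQAlgebraLatticeInvertibleClassesFinite
import Mathlib.RingTheory.Artinian.Ring
import HarnessLib

/-!
# Hertling–Larabi 2026 THEOREM 6.5 («an extension of the Jordan-Zassenhaus theorem», one of the «five main results»
# of the paper): for EVERY finite-dimensional commutative `ℚ`-algebra `A` — nilpotent elements allowed — and every
# order `Λ`, the `ε`-classes `{[L]_ε | 𝒪(L) = Λ}` of the EXACT `Λ`-ideals form a FINITE set

[topic NumberTheory/ComplexMultiplication] General-`A` series (namespace
`Literature.NumberTheory.ComplexMultiplication.FiniteQAlgebraLattice`; full lattices `IsFullLattice A L`, orders,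
`𝒪(L) = L / L`, `ε`-classes as the quotient type by `L ∼ uL`, `u ∈ A^{unit}`).  Sequel of
`FiniteQAlgebraLatticeClassesFinite` (Thm. 6.3 = Jordan–Zassenhaus for separable `A`, Thm. 6.4; its docstring: «NOT
here: HL 2026 Thm. 6.5») and `FiniteQAlgebraLatticeInvertibleClassesFinite` (Thm. 6.5 on the INVERTIBLE exact
`Λ`-ideals only; its docstring: «NOT here: Thm. 6.5 for the NON-invertible exact `Λ`-ideals (HL's Steps 2–3, socle
filtration)») — supplied here: THEOREM 6.5 IN FULL, by the printed three-step proof.  Lane `lit-hodgefound`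
(Track 2 foundations library), seat p19 generation 38, row g38-#1.  THEOREMS ONLY: no definition, no instance, no
notation, no named fact (D-0026, net Literature debt `0`), no `sorry`.

## Source, VERBATIM

C. Hertling, K. Larabi, *Semigroups from full lattices in commutative ℚ-algebras*, arXiv:2602.14973 (2026)
[HertlingLarabi2026], held `paper:arxiv-2602.14973`, §6 (chunk p0015):
«But if one restricts to exact `Λ`-ideals, Theorem 6.3 generalizes to not separable algebras. This extension of the
Jordan-Zassenhaus theorem in Theorem 6.5 is one of the five main results of this paper. In the case of an algebra `A`
with radical `R` with `R² = 0` it was proved by Faddeev [Fa67].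
**Theorem 6.5.** Let `A` be as in Theorem 3.1, so `A` is a finite dimensional commutative `ℚ`-algebra with unit
element. For any order `Λ` in `A`, the set `{[L]_ε | L ∈ 𝓛(A), 𝒪(L) = Λ}` of `ε`-classes of exact `Λ`-ideals is
finite.»  Remarks 6.6 (iii) (chunk p0015): «Our proof below of Theorem 6.5 and Faddeev's proof for the case with
`R² = 0` in [Fa67] have both three steps. […] our step 3 […] uses the socle filtration in Lemma 3.3 together with the
action of `R^{[1]}` on it (also in Lemma 3.3) and Lemma 2.3.»
The proof (chunks p0016–p0017). STEP 1: «there is a natural isomorphism `F ≅ R^{[0]} = R^0/R^1 = A/R`. […] For each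
full lattice `L` in `A`, its image under the projection to `R^{[0]}` is called `L^{[0]}`. […] An `ε`-class of full
lattices in `A` projects by `L ↦ L^{[0]}` to an `ε`-class of full lattices in `F`. By the Jordan-Zassenhaus theorem
6.3 the set of `ε`-classes of `Λ^{[0]}`-ideals in `F` is finite, so it can be indexed by a finite set `I`. We choose
for each `i ∈ I` a representative `K^i ∈ 𝓛(F)`. We can choose it and will choose it such that `1_A ∈ K^i`. Each
`ε`-class of exact `Λ`-ideals contains full lattices `L` with `L^{[0]} = K^i` for some `i ∈ I`. If `1_A ∉ L` for such
an `L`, then `1_A + r ∈ L` for some `r ∈ R`, because `L^{[0]} = K^i` and `1_A ∈ K^i`. Then we replace `L` by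
`L̃ := (1_A + r)⁻¹L`. It satisfies `[L̃]_ε = [L]_ε`, `L̃^{[0]} = L^{[0]} = K^i` and `1_A ∈ L̃`. Finally, for an exact
`Λ`-ideal `L` the condition `1_A ∈ L` is equivalent to the condition `L ⊃ Λ`. Therefore it is sufficient to show for
each `i ∈ I` that the set `{[L]_ε | L ∈ 𝓛(A) with 𝒪(L) = Λ, L^{[0]} = K^i, L ⊃ Λ}` (6.2) is finite. In fact, we will
show for each `i ∈ I` that the set `{L | L ∈ 𝓛(A) with 𝒪(L) = Λ, L^{[0]} = K^i, L ⊃ Λ}` (6.3) is finite.»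
STEP 2: «Recall from Lemma 3.3 that `S_{[1]} = S_1 = Ann(R) ⊂ A` is the socle of `A`, that `Λ_{[1]} = Λ ∩ S_1` and
that `L_{[1]} = L ∩ S_1` for any full lattice `L` in `A`. In step 2 we will show for each `i ∈ I` that the set
`{L_{[1]} | L ∈ 𝓛(A) with 𝒪(L) = Λ, L^{[0]} = K^i, L ⊃ Λ}` (6.4) is finite. For `L` with `𝒪(L) = Λ` and
`L^{[0]} = K^i` the condition `Λ = L:L` and the multiplication map `R^{[0]} × S_1 → S_1` in Lemma 3.3 yield the
condition `Λ_{[1]} = Λ ∩ S_1 = (L ∩ S_1):L^{[0]} = L_{[1]}:K^i`. This condition indeed bounds `L_{[1]} = L ∩ S_1`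
from above […] There is a natural number `r` with `r · Λ_max(F) ⊂ Λ^{[0]}` by Lemma 2.2 (c). […] This bounds
`L_{[1]}` from above. `L_{[1]}` is bounded from below by `L_{[1]} ⊃ Λ_{[1]}` because `L ⊃ Λ`. By Lemma 2.2 (d) the
set in (6.4) is finite.»
STEP 3: «We will show for each `i ∈ I` inductively for `m ∈ {1, 2, …, n_max + 1}` that the set of tuples
`{(L_{[m]}, L_{[m−1]}, …, L_{[1]}) | L ∈ 𝓛(A) with 𝒪(L) = Λ, L^{[0]} = K^i, L ⊃ Λ}` (6.5) is finite. Step 2 shows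
this for `m = 1`. Suppose it is true for some `m ≤ n_max`. […] We apply Lemma 3.3 and Lemma 2.3 (a) with
`(V_1, V_2, V_3, β) ∼ (R^{[1]}, S_{[m+1]}, S_{[m]}, multiplication)`. Then `Λ^{[1]} · L_{[m+1]} ⊂ L_{[m]} = K_m`, so
`L_{[m+1]} ⊂ K_m : Λ^{[1]}`. `L_{[m+1]}` is therefore bounded from above by the full lattice `K_m : Λ^{[1]}` in
`S_{[m+1]}`. It is bounded from below by `L_{[m+1]} ⊃ Λ_{[m+1]}` because `L ⊃ Λ`. Therefore the set in (6.6) is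
finite. The set in (6.5) is finite for any `m`, especially for `m = n_max + 1`. We conclude with Lemma 2.4 (c)
with `V = A` and `V_• = S_•` that the set in (6.3) is finite.»
Lemma 3.3 (b) (chunks p0007–p0008): «`S_l := Ann(R^l)` for `l ∈ {0, 1, …, n_max + 1}`,
`{0} = S_0 ⊂ S_1 ⊂ … ⊂ S_{n_max} ⊂ S_{n_max+1} = A`. It is called socle filtration […] It satisfies
`R^{l_1} · S_{l_2} ⊂ S_{l_2−l_1}` for `l_1 < l_2` (3.8) […] The homomorphisms `μ^{[l_2]}_{a_i} : S_{[l_2]} → S_{[l_2−l_1]},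
b ↦ a_i · b` satisfy `⋂_i ker μ^{[l_2]}_{a_i} = {0} ⊂ S_{[l_2]}` (3.10). […] Proof: […] Suppose `b ∈ S_{[l_2]}` with
`a_i · b = 0 ∈ S_{[l_2−l_1]}` for each `i`. […] Therefore `R^{l_1} · b̃ ⊂ S_{l_2−l_1−1}`, so
`R^{l_2−1} · b̃ = R^{l_2−l_1−1} · R^{l_1} · b̃ ⊂ R^{l_2−l_1−1} · S_{l_2−l_1−1} = {0}`. This implies `b̃ ∈ S_{l_2−1}`, so
`b = 0`.»  Lemma 2.3 (a) (chunk p0005): «Then the set `L_3:L_1 := {b ∈ V_2 | β(., b)(L_1) ⊂ L_3}` is a full lattice in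
`V_2`»; Lemma 2.4 (c) (chunk p0005): «Fix `L ∈ 𝓛(V)`. Consider for any `j ∈ {1, …, n}` a finite set
`{K_{j,1}, …, K_{j,l_j}} ⊂ 𝓛(V_{[j]})`. Then the set `{K ∈ 𝓛(V) | K ⊃ L, K_{[j]} ∈ {K_{j,1}, …, K_{j,l_j}} for j}` is
finite.»

## How the printed proof is followed (same architecture; two steps shortened where the tree allows)

* `pr_F : A = F ⊕ R → F` is, as in the sequel files, a surjective ring homomorphism `π : A → B` whose kernel
  `R := ker π` is a NILPOTENT ideal (§§2–4), specialised in the headline theorem to `A → A/nilradical(A)` (reduced =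
  separable, finite-dimensional; `nilradical(A)` is nilpotent because `A` is artinian).  The socle filtration is
  `S_j := Ann(R^j)` (`Submodule.annihilator (R ^ j)`), with (3.8) `R·S_{j+1} ⊆ S_j` and (3.10) in the form
  «`R·b ⊆ S_j ⟹ b ∈ S_{j+1}`» (§1).
* STEP 1 exactly as printed (§4): Jordan–Zassenhaus downstairs is the hypothesis «the `ε`-classes of full
  `π(Λ)`-ideals of `B` are finite» (discharged by `FiniteQAlgebraLatticeClassesFinite.finite_quot_isFullLattice_of_isReduced`);
  representatives `K_c ∋ 1` (a nonzero integer of a full lattice is a unit); units of `B` lift to units of `A` and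
  `1 + r`, `r ∈ R`, is a unit (`FiniteQAlgebraLatticeRadicalProjectionInjective`), so every class of exact `Λ`-ideals
  meets one of the finitely many sets (6.3) `{L | 𝒪(L) = Λ, Λ ⊆ L, π(L) = K_c}`.
* STEP 2 (§2), the bound on `L_{[1]} = L ∩ S_1`: HL dualise (`Λ_{[1]}^{*ℤ} = L_{[1]}^{*ℤ}·K^i`, Lemma 2.3 (b)) and
  invert `K^i·Λ_max(F)` (Cor. 6.2) to bound `L_{[1]}` by a lattice built from «a natural number `r` with
  `r·Λ_max(F) ⊂ Λ^{[0]}`».  SHORTER ROAD taken here, from the same two inputs «`Λ = L:L`» and «`R·S_1 = 0`»: with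
  `r ∈ ℤ ∖ 0` such that `r·K ⊆ π(Λ)` one has directly `r·(L ∩ S_1) ⊆ Λ ∩ S_1` (for `s ∈ L ∩ S_1`, `a ∈ L` pick
  `λ ∈ Λ` with `π(λ) = π(ra)`; then `(rs)a = sλ + s(ra − λ) = sλ ∈ L`, so `rs ∈ L:L = Λ`), whence the window
  `Λ ∩ S_1 ⊆ L ∩ S_1 ⊆ r⁻¹(Λ ∩ S_1)` is finite («Lemma 2.2 (d)» = the tree's `finite_setOf_le_and_smul_mem`).
* STEP 3 (§3), the induction `m → m+1`, without subquotient types: instead of the tuple `(L_{[m]}, …, L_{[1]})` the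
  induction tracks `L ∩ S_m` (which determines the tuple), i.e. shows «`{L ∩ S_m | L in (6.3)}` is finite» for
  `m = 1, 2, …`; `Ψ(b) := (a·b mod S_{m−1})_a`, `a` running over generators of `Λ ∩ R`, is HL's family
  `μ^{[m+1]}_{a_i}` with `ker Ψ = S_m` by (3.10); `Λ^{[1]}·L_{[m+1]} ⊂ L_{[m]} = K_m` reads `L ∩ S_{m+1} ⊆ Ψ⁻¹(∏ K̄_m)`,
  and Lemma 2.3 (a) («`K_m : Λ^{[1]}` is a full lattice») is replaced by its finitely-generated core (lifting the
  finitely many generators of `Ψ(L ∩ S_{m+1}) ⊆ ∏ K̄_m` over the noetherian ring `ℤ`: `L ∩ S_{m+1} ⊆ Q + S_m`, `Q`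
  finitely generated); finally Lemma 2.4 (c) (the index count `[K:L] = ∏_j [K_{[j]}:L_{[j]}]`) is replaced by a direct
  sandwich: with `kQ ⊆ Λ`, `L ∩ S_{m+1}` lies in the finitely generated `N := (Q + k⁻¹K_m) ∩ S_{m+1}` and contains
  `kN`, a finite window.  At `m = n + 1` with `R^n = 0`, `S_m = A` and (6.3) is finite.

## What is proved (all for commutative rings `A ⊇ ℚ`; `π : A →+* B`; lattices are `ℤ`-submodules)

* §1 socle filtration: `mul_mem_annihilator_pow` (3.8), `mem_annihilator_pow_succ_of_forall_mul_mem` (3.10),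
  `annihilator_pow_le_annihilator_pow_succ`, `annihilator_pow_eq_top_of_pow_eq_bot`.
* §2 STEP 2: `zsmul_mem_of_mem_annihilator_ker` (`r(L ∩ Ann R) ⊆ Λ`), `finite_setOf_inf_annihilator_ker` ((6.4) is
  finite).
* §3 STEP 3: `finite_setOf_inf_annihilator_pow_succ` (the induction step (6.5) ⟹ (6.6)),
  `finite_setOf_div_self_eq_and_le_and_map_eq` (**(6.3) is finite**: the exact `Λ`-ideals `L ⊇ Λ` with `π(L) = K`).
* §4 STEP 1 and the theorem: `exists_units_smul_one_mem` (`1_A ∈ K^i`), `exists_units_smul_le_and_map_eq`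
  (`L̃ = (1+r)⁻¹uL ⊇ Λ`, `π(L̃) = K`), `finite_quot_div_self_eq_of_finite_quot_map` (Thm. 6.5 from Jordan–Zassenhaus
  downstairs, for any surjective `π` with nilpotent kernel), **`finite_quot_div_self_eq` — THEOREM 6.5**,
  `exists_finset_forall_div_self_eq_exists_units_smul_mem` (a finite system of representatives), and
  `finite_quot_div_self_eq_and_infinite_quot_of_not_isReduced` (Thm. 6.5 against Thm. 6.4: for non-separable `A`
  the exact classes over `Λ` are finite while all classes over `Λ` are infinite).
NOT here: Remarks 6.6 (i) (the equivalence 6.5 ⟺ 6.3 for separable `A` via the finitely many intermediate orders —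
`FiniteQAlgebraLatticeMaximalOrder`), 6.6 (ii) (Faddeev's noncommutative counterexample), and HL's sharper Step-2
bound through dual lattices.

## References

* [HertlingLarabi2026] C. Hertling, K. Larabi, *Semigroups from full lattices in commutative ℚ-algebras*,
  arXiv:2602.14973 (2026): §6 Thm. 6.5, Rem. 6.6 (iii) and the proof of Thm. 6.5, Steps 1–3, (6.2)–(6.6) (chunks
  p0015–p0017); §3 Lemma 3.3 (b) (3.8), (3.10) (chunks p0007–p0008); §2 Lemma 2.2 (c)(d), Lemma 2.3 (a),
  Lemma 2.4 (c) (chunks p0005–p0006). [cite: HertlingLarabi2026, §6 Thm. 6.5 and its proof, chunks p0015–p0017]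
* [HertlingLarabi2026b] C. Hertling, K. Larabi, *Conjugacy classes of regular integer matrices*, arXiv:2602.15748
  (2026), §5 (before Thm. 5.10: «the finite group `G([Λ]_ε)`», the invertible part of the finite set here).
  [cite: HertlingLarabi2026b, §5 Thm. 5.10 (preamble), chunk p0010]
* [Faddeev1967ExactIdeals] D. K. Faddeev, *The number of classes of exact ideals for Z-rings*, Mat. Zametki 1
  (1967) 625–632; Math. Notes 1 (1967) 415–419 — [Fa67] of [HertlingLarabi2026] §6 («In the case of an algebra `A`
  with radical `R` with `R² = 0` it was proved by Faddeev [Fa67]»); not consulted — the proof followed is HL's.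
  [cite: Faddeev1967ExactIdeals, as cited by HertlingLarabi2026 §6 before Thm. 6.5]
-/

noncomputable section

open scoped Pointwise
open Module Function Submodule

open Literature.NumberTheory.Automorphic (IsFullLattice mem_units_smul_submodule_iff exists_smul_mem_of_fg
  finite_setOf_le_and_smul_mem)
open Literature.LinearAlgebra.Matrix.LatimerMacDuffeeSquarefree (equivalence_exists_units_smul)

namespace Literature.NumberTheory.ComplexMultiplication.FiniteQAlgebraLattice

/-! ## §0 Two lemmas on finitely generated modules (used over the noetherian ring `ℤ`) -/

section Helpers

variable {R : Type*} [Ring R] [IsNoetherianRing R] {V W : Type*} [AddCommGroup V] [Module R V]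
  [AddCommGroup W] [Module R W]

/-- A submodule of a finitely generated module over a noetherian ring is finitely generated. [folklore] -/
private theorem fg_of_fg_of_le {N U : Submodule R V} (hU : U.FG) (h : N ≤ U) : N.FG := by
  haveI : IsNoetherian R U := isNoetherian_of_fg_of_noetherian U hU
  exact Submodule.FG.of_le_of_isNoetherian h

omit [IsNoetherianRing R] in
/-- Lifting generators (the finitely-generated core of HL's Lemma 2.3 (a), «`L_3:L_1` is a full lattice»): if the
image `f(N)` of a submodule `N` under a linear map `f` is finitely generated, then `N ⊆ Q + ker f` for a finitely
generated `Q ⊆ N`. [cite: HertlingLarabi2026, §2 Lemma 2.3 (a), chunk p0005] -/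
private theorem exists_fg_le_and_le_sup_ker (f : V →ₗ[R] W) {N : Submodule R V} (hN : (N.map f).FG) :
    ∃ Q : Submodule R V, Q.FG ∧ Q ≤ N ∧ N ≤ Q ⊔ LinearMap.ker f := by
  classical
  obtain ⟨s, hs⟩ := hN
  have hmem : ∀ y ∈ s, ∃ x ∈ N, f x = y := fun y hy => by
    have hy' : y ∈ N.map f := hs ▸ subset_span hy
    exact Submodule.mem_map.1 hy'
  choose g hgN hgf using hmem
  refine ⟨span R (Set.range fun y : s => g y.1 y.2), fg_span (Set.finite_range _), span_le.2 ?_, fun b hb => ?_⟩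
  · rintro _ ⟨y, rfl⟩
    exact hgN y.1 y.2
  · have hfb : f b ∈ (span R (Set.range fun y : s => g y.1 y.2)).map f := by
      have hb' : f b ∈ span R (s : Set W) := hs ▸ mem_map_of_mem hb
      refine (span_le.2 fun y hy => ?_) hb'
      exact ⟨g y hy, subset_span ⟨⟨y, hy⟩, rfl⟩, hgf y hy⟩
    obtain ⟨q, hq, hqb⟩ := hfb
    exact mem_sup.2 ⟨q, hq, b - q, by simp [hqb], add_sub_cancel q b⟩

end Helpers

/-! ## §1 The socle filtration `S_j = Ann(R^j)` (Lemma 3.3 (b)) -/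

section Filtration

variable {A : Type} [CommRing A]

/-- **LEMMA 3.3 (b), (3.8): `R · S_{j+1} ⊆ S_j`** for the socle filtration `S_j := Ann(R^j)` of an ideal `R`
(«`R^{l_1} · S_{l_2} ⊂ S_{l_2−l_1}` for `l_1 < l_2`», the case `l_1 = 1`).
[cite: HertlingLarabi2026, §3 Lemma 3.3 (b) (3.8), chunk p0007] -/
theorem mul_mem_annihilator_pow {R : Ideal A} {j : ℕ} {r b : A} (hr : r ∈ R)
    (hb : b ∈ (R ^ (j + 1)).annihilator) : r * b ∈ (R ^ j).annihilator := by
  rw [Submodule.mem_annihilator] at hb ⊢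
  intro x hx
  have hrx : r * x ∈ R ^ (j + 1) := by
    rw [pow_succ']
    exact Ideal.mul_mem_mul hr hx
  rw [smul_eq_mul, show r * b * x = b * (r * x) by ring]
  exact hb _ hrx

/-- **LEMMA 3.3 (b), (3.10) — the joint kernel of the multiplications `R^{[1]} × S_{[j+1]} → S_{[j]}` is trivial:
if `R·b ⊆ S_j = Ann(R^j)` then `b ∈ S_{j+1}`** («Therefore `R^{l_1} · b̃ ⊂ S_{l_2−l_1−1}`, so
`R^{l_2−1} · b̃ = R^{l_2−l_1−1} · R^{l_1} · b̃ ⊂ R^{l_2−l_1−1} · S_{l_2−l_1−1} = {0}`. This implies `b̃ ∈ S_{l_2−1}`»,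
the case `l_1 = 1`). [cite: HertlingLarabi2026, §3 Lemma 3.3 (b) (3.10) and its proof, chunks p0007–p0008] -/
theorem mem_annihilator_pow_succ_of_forall_mul_mem {R : Ideal A} {j : ℕ} {b : A}
    (h : ∀ r ∈ R, r * b ∈ (R ^ j).annihilator) : b ∈ (R ^ (j + 1)).annihilator := by
  rw [Submodule.mem_annihilator]
  intro x hx
  rw [pow_succ'] at hx
  refine Submodule.mul_induction_on hx (fun r hr y hy => ?_)
    (fun x y hx hy => by rw [smul_add, hx, hy, add_zero])
  have hrb := Submodule.mem_annihilator.1 (h r hr) y hy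
  rw [smul_eq_mul] at hrb ⊢
  rw [show b * (r * y) = r * b * y by ring]
  exact hrb

/-- The socle filtration is increasing: `S_j ⊆ S_{j+1}`. [cite: HertlingLarabi2026, §3 Lemma 3.3 (b), chunk p0007] -/
theorem annihilator_pow_le_annihilator_pow_succ (R : Ideal A) (j : ℕ) :
    (R ^ j).annihilator ≤ (R ^ (j + 1)).annihilator :=
  Submodule.annihilator_mono (Ideal.pow_le_pow_right (Nat.le_succ j))

/-- `S_n = A` once `R^n = 0` («`S_{n_max+1} = A`»). [cite: HertlingLarabi2026, §3 Lemma 3.3 (b), chunk p0007] -/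
theorem annihilator_pow_eq_top_of_pow_eq_bot {R : Ideal A} {n : ℕ} (h : R ^ n = ⊥) :
    (R ^ n).annihilator = ⊤ := by
  rw [h, Submodule.annihilator_bot]

/-- Ideals of a `ℚ`-algebra are divisible: `n • y ∈ I`, `n ≠ 0` ⟹ `y ∈ I`. [folklore] -/
private theorem mem_ideal_of_zsmul_mem [Algebra ℚ A] {I : Ideal A} {n : ℤ} (hn : n ≠ 0) {y : A} (h : n • y ∈ I) :
    y ∈ I := by
  have e : y = algebraMap ℚ A ((n : ℚ)⁻¹) * (n • y) := by
    rw [zsmul_eq_mul, ← mul_assoc, ← map_intCast (algebraMap ℚ A) n, ← map_mul,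
      inv_mul_cancel₀ (by exact_mod_cast hn), map_one, one_mul]
  rw [e]
  exact I.mul_mem_left _ h

end Filtration

/-! ## §2 Step 2 of the proof of Theorem 6.5: the socle part `L ∩ S_1` of an exact `Λ`-ideal is bounded -/

section StepTwo

variable {A B : Type} [CommRing A] [CommRing B]

/-- **THEOREM 6.5, STEP 2 (the bound on `L_{[1]} = L ∩ S_1`)** — for a ring homomorphism `π : A → B` with kernel
`R`, an exact `Λ`-ideal `L` (`L:L = Λ`) with `π(L) = K`, and an integer `r` with `r·K ⊆ π(Λ)`:
**`r · (L ∩ Ann R) ⊆ Λ`**.  HL derive from «the condition `Λ = L:L` and the multiplication map `R^{[0]} × S_1 → S_1`»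
the identity `Λ_{[1]} = L_{[1]} : K^i` and bound `L_{[1]}` above through dual lattices and «a natural number `r`
with `r · Λ_max(F) ⊂ Λ^{[0]}`»; here the bound is read off directly: for `s ∈ L ∩ Ann R` and `a ∈ L` pick `λ ∈ Λ`
with `π(λ) = π(ra)`; then `(rs)a = sλ + s(ra − λ) = sλ ∈ ΛL ⊆ L`, so `rs ∈ L:L = Λ`.
[cite: HertlingLarabi2026, §6 proof of Thm. 6.5, Step 2, chunk p0016] -/
theorem zsmul_mem_of_mem_annihilator_ker {π : A →+* B} {Λ L : Submodule ℤ A} (hO : L / L = Λ)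
    {K : Submodule ℤ B} (hLK : L.map (π : A →+ B).toIntLinearMap = K) {r : ℤ}
    (hr : ∀ y ∈ K, r • y ∈ Λ.map (π : A →+ B).toIntLinearMap)
    {s : A} (hsL : s ∈ L) (hs : s ∈ (RingHom.ker π).annihilator) : r • s ∈ Λ := by
  rw [← hO, Submodule.mem_div_iff_forall_mul_mem]
  intro a ha
  obtain ⟨l, hl, hla⟩ : ∃ l ∈ Λ, π l = π (r • a) := by
    have haK : (π : A →+ B).toIntLinearMap a ∈ K := hLK ▸ mem_map_of_mem ha
    have h1 : r • (π : A →+ B).toIntLinearMap a ∈ Λ.map (π : A →+ B).toIntLinearMap := hr _ haK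
    obtain ⟨l, hl, e⟩ := Submodule.mem_map.1 h1
    refine ⟨l, hl, ?_⟩
    simpa using e
  have hker : r • a - l ∈ RingHom.ker π := by
    rw [RingHom.mem_ker, map_sub, hla, sub_self]
  have h0 : s * (r • a - l) = 0 := by
    have := Submodule.mem_annihilator.1 hs _ hker
    rwa [smul_eq_mul] at this
  have e : r • s * a = l * s + s * (r • a - l) := by
    simp only [zsmul_eq_mul]
    ring
  rw [e, h0, add_zero]
  rw [← hO] at hl
  exact (Submodule.mem_div_iff_forall_mul_mem.1 hl) s hsL

variable [Algebra ℚ A]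

/-- **THEOREM 6.5, STEP 2 (finiteness of the set (6.4))** — for a surjective ring homomorphism `π : A → B`, a
full lattice `Λ` and a finitely generated `K ⊆ B`: over the exact `Λ`-ideals `L ⊇ Λ` with `π(L) = K`, **the socle
parts `L ∩ Ann(ker π)` form a FINITE set** («This bounds `L_{[1]}` from above. `L_{[1]}` is bounded from below by
`L_{[1]} ⊃ Λ_{[1]}` because `L ⊃ Λ`. By Lemma 2.2 (d) the set in (6.4) is finite.»): they lie between `Λ ∩ Ann R` and
`r⁻¹(Λ ∩ Ann R)`. [cite: HertlingLarabi2026, §6 proof of Thm. 6.5, Step 2, (6.4), chunk p0016] -/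
theorem finite_setOf_inf_annihilator_ker {π : A →+* B} (hπ : Surjective π) {Λ : Submodule ℤ A}
    (hΛ : IsFullLattice A Λ) {K : Submodule ℤ B} (hK : K.FG) :
    {M : Submodule ℤ A | ∃ L : Submodule ℤ A, (L / L = Λ ∧ Λ ≤ L ∧ L.map (π : A →+ B).toIntLinearMap = K) ∧
      M = L ⊓ ((RingHom.ker π).annihilator).restrictScalars ℤ}.Finite := by
  haveI : IsAddTorsionFree A := IsAddTorsionFree.of_isTorsionFree ℚ A
  obtain ⟨r, hr0, hr⟩ := exists_smul_mem_of_fg (isFullLattice_map_of_surjective hπ hΛ) hK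
  set T₁ : Submodule ℤ A := ((RingHom.ker π).annihilator).restrictScalars ℤ
  set f : A →ₗ[ℤ] A := DistribSMul.toLinearMap ℤ A r
  have hfapp : ∀ x, f x = r • x := fun _ => rfl
  have hfinj : Injective f := fun x y hxy => smul_right_injective A hr0 (by simpa [hfapp] using hxy)
  set N : Submodule ℤ A := (Λ ⊓ T₁).comap f with hN
  have hNfg : N.FG :=
    fg_of_fg_map_injective f hfinj (fg_of_fg_of_le (fg_of_fg_of_le hΛ.1 inf_le_left) (map_comap_le _ _))
  refine (finite_setOf_le_and_smul_mem N hNfg hr0).subset ?_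
  rintro M ⟨L, ⟨hO, hΛL, hLK⟩, rfl⟩
  refine ⟨fun m hm => ?_, fun x hx => ?_⟩
  · rw [hN, Submodule.mem_comap, hfapp]
    exact ⟨zsmul_mem_of_mem_annihilator_ker hO hLK hr hm.1 hm.2, T₁.smul_mem _ hm.2⟩
  · rw [hN, Submodule.mem_comap, hfapp] at hx
    exact ⟨hΛL hx.1, hx.2⟩

end StepTwo

/-! ## §3 Step 3 of the proof of Theorem 6.5: climbing the socle filtration -/

section StepThree

variable {A B : Type} [CommRing A] [CommRing B] [Algebra ℚ A]

/-- **THEOREM 6.5, STEP 3 (the induction `m → m+1` on the socle filtration)** — for a ring homomorphism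
`π : A → B` with kernel `R`, a full lattice `Λ`, `j ≥ 1`, and a family `S` of finitely generated lattices `L ⊇ Λ`
with `ΛL ⊆ L`: **if the `L ∩ S_j`, `L ∈ S`, form a finite set, so do the `L ∩ S_{j+1}`** (`S_j = Ann(R^j)`).
HL: «`Λ^{[1]} · L_{[m+1]} ⊂ L_{[m]} = K_m`, so `L_{[m+1]} ⊂ K_m : Λ^{[1]}`. `L_{[m+1]}` is therefore bounded from
above by the full lattice `K_m : Λ^{[1]}` in `S_{[m+1]}` [Lemma 2.3 (a) with (3.10)]. It is bounded from below by
`L_{[m+1]} ⊃ Λ_{[m+1]}` because `L ⊃ Λ`. Therefore the set in (6.6) is finite» and Lemma 2.4 (c).  Here, without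
subquotients: `Ψ(b) := (a·b mod S_{j−1})_{a}` over generators `a` of `Λ ∩ R` has `ker Ψ ⊆ S_j` by (3.10); for
`L ∩ S_j = K_j` fixed, `L ∩ S_{j+1} ⊆ Ψ⁻¹(∏ K̄_j) ⊆ Q + S_j` with `Q` finitely generated (lifting generators), and
with `kQ ⊆ Λ`: `L ∩ S_{j+1} ⊆ (Q + k⁻¹K_j) ∩ S_{j+1}`, a finitely generated lattice `N` with `kN ⊆ L ∩ S_{j+1}` — a
finite window. [cite: HertlingLarabi2026, §6 proof of Thm. 6.5, Step 3, (6.5)–(6.6), chunks p0016–p0017]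
[cite: HertlingLarabi2026, §2 Lemma 2.3 (a), Lemma 2.4 (c), chunks p0005–p0006] -/
theorem finite_setOf_inf_annihilator_pow_succ (π : A →+* B) {Λ : Submodule ℤ A} (hΛ : IsFullLattice A Λ)
    {S : Set (Submodule ℤ A)} (hS : ∀ L ∈ S, L.FG ∧ Λ ≤ L ∧ Λ * L ≤ L) {j : ℕ} (hj : 1 ≤ j)
    (hfin : {M : Submodule ℤ A | ∃ L ∈ S,
      M = L ⊓ ((RingHom.ker π ^ j).annihilator).restrictScalars ℤ}.Finite) :
    {M : Submodule ℤ A | ∃ L ∈ S,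
      M = L ⊓ ((RingHom.ker π ^ (j + 1)).annihilator).restrictScalars ℤ}.Finite := by
  classical
  haveI : IsAddTorsionFree A := IsAddTorsionFree.of_isTorsionFree ℚ A
  set R : Ideal A := RingHom.ker π
  set Tp : Submodule ℤ A := ((R ^ (j - 1)).annihilator).restrictScalars ℤ
  set Tj : Submodule ℤ A := ((R ^ j).annihilator).restrictScalars ℤ
  set Ts : Submodule ℤ A := ((R ^ (j + 1)).annihilator).restrictScalars ℤ
  -- generators of `Λ ∩ R`
  obtain ⟨s, hs⟩ := fg_of_fg_of_le hΛ.1 (inf_le_left : Λ ⊓ R.restrictScalars ℤ ≤ Λ)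
  have hsΛR : ∀ a : s, (a : A) ∈ Λ ∧ (a : A) ∈ R := fun a => by
    have : (a : A) ∈ Λ ⊓ R.restrictScalars ℤ := hs ▸ subset_span a.2
    exact this
  -- `Ψ(b) = (a·b mod S_{j-1})_{a ∈ s}`
  set Ψ := LinearMap.pi fun a : s => Tp.mkQ ∘ₗ (AddMonoidHom.mulLeft (a : A)).toIntLinearMap
  have hΨ : ∀ (b : A) (a : s), Ψ b a = Tp.mkQ ((a : A) * b) := fun _ _ => rfl
  -- (3.10): `ker Ψ ⊆ S_j`
  have hker : LinearMap.ker Ψ ≤ Tj := by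
    intro b hb
    have h1 : ∀ a : s, (a : A) * b ∈ (R ^ (j - 1)).annihilator := fun a => by
      have e := congr_fun (LinearMap.mem_ker.1 hb) a
      rw [hΨ, Pi.zero_apply, Submodule.mkQ_apply, Submodule.Quotient.mk_eq_zero] at e
      exact e
    have h2 : ∀ r ∈ R, r * b ∈ (R ^ (j - 1)).annihilator := fun r hr => by
      obtain ⟨n, hn0, hn⟩ := hΛ.2 r
      have hnr : n • r ∈ span ℤ (s : Set A) := by
        rw [hs]
        exact ⟨hn, (R.restrictScalars ℤ).smul_mem n hr⟩
      -- `x ↦ x·b ∈ Ann(R^{j-1})` is a `ℤ`-submodule containing `s`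
      have hP : span ℤ (s : Set A) ≤
          (((R ^ (j - 1)).annihilator).restrictScalars ℤ).comap (AddMonoidHom.mulRight b).toIntLinearMap :=
        span_le.2 fun a ha => h1 ⟨a, ha⟩
      have h3 : n • r * b ∈ (R ^ (j - 1)).annihilator := hP hnr
      rw [smul_mul_assoc] at h3
      exact mem_ideal_of_zsmul_mem hn0 h3
    have h4 := mem_annihilator_pow_succ_of_forall_mul_mem h2
    rwa [Nat.sub_add_cancel hj] at h4
  -- reduce to the fibres over the finitely many `K_j = L ∩ S_j`
  have hsub : {M : Submodule ℤ A | ∃ L ∈ S, M = L ⊓ Ts} ⊆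
      ⋃ K ∈ {K : Submodule ℤ A | ∃ L ∈ S, K = L ⊓ Tj},
        {M : Submodule ℤ A | ∃ L ∈ S, L ⊓ Tj = K ∧ M = L ⊓ Ts} := by
    rintro M ⟨L, hL, rfl⟩
    exact Set.mem_biUnion (show L ⊓ Tj ∈ {K : Submodule ℤ A | ∃ L ∈ S, K = L ⊓ Tj} from ⟨L, hL, rfl⟩)
      ⟨L, hL, rfl, rfl⟩
  refine (hfin.biUnion fun K hK => ?_).subset hsub
  obtain ⟨L₀, hL₀, rfl⟩ := hK
  -- the fibre over `K_j = L₀ ∩ S_j`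
  have hKfg : (L₀ ⊓ Tj).FG := fg_of_fg_of_le (hS L₀ hL₀).1 inf_le_left
  set P := Submodule.pi Set.univ fun _ : s => (L₀ ⊓ Tj).map Tp.mkQ with hPdef
  have hPfg : P.FG := Submodule.fg_pi fun _ => hKfg.map _
  set N : Submodule ℤ A := P.comap Ψ with hNdef
  have hNfg : (N.map Ψ).FG := fg_of_fg_of_le hPfg (map_comap_le _ _)
  obtain ⟨Q, hQfg, -, hNQ⟩ := exists_fg_le_and_le_sup_ker Ψ hNfg
  obtain ⟨k, hk0, hk⟩ := exists_smul_mem_of_fg hΛ hQfg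
  set f : A →ₗ[ℤ] A := DistribSMul.toLinearMap ℤ A k
  have hfapp : ∀ x, f x = k • x := fun _ => rfl
  have hfinj : Injective f := fun x y hxy => smul_right_injective A hk0 (by simpa [hfapp] using hxy)
  set C : Submodule ℤ A := (L₀ ⊓ Tj).comap f with hCdef
  have hCfg : C.FG := fg_of_fg_map_injective f hfinj (fg_of_fg_of_le hKfg (map_comap_le _ _))
  set NK : Submodule ℤ A := (Q ⊔ C) ⊓ Ts
  have hNKfg : NK.FG := fg_of_fg_of_le (hQfg.sup hCfg) inf_le_left
  refine (finite_setOf_le_and_smul_mem NK hNKfg hk0).subset ?_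
  rintro M ⟨L, hL, hLK, rfl⟩
  obtain ⟨-, hΛL, hΛLL⟩ := hS L hL
  refine ⟨fun b hb => ?_, fun x hx => ?_⟩
  · -- `L ∩ S_{j+1} ⊆ NK`
    have hbL : b ∈ L := hb.1
    have hbT : b ∈ (R ^ (j + 1)).annihilator := hb.2
    have hbN : b ∈ N := by
      rw [hNdef, Submodule.mem_comap, hPdef, Submodule.mem_pi]
      intro a _
      rw [hΨ]
      refine mem_map_of_mem ?_
      rw [← hLK]
      exact ⟨hΛLL (mul_mem_mul (hsΛR a).1 hbL), mul_mem_annihilator_pow (hsΛR a).2 hbT⟩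
    obtain ⟨q, hq, t, ht, rfl⟩ := mem_sup.1 (hNQ hbN)
    have htT : t ∈ Tj := hker ht
    have hkt : k • t ∈ L₀ ⊓ Tj := by
      rw [← hLK]
      refine ⟨?_, Tj.smul_mem _ htT⟩
      have e : k • t = k • (q + t) - k • q := by rw [smul_add]; abel
      rw [e]
      exact sub_mem (L.smul_mem _ hbL) (hΛL (hk q hq))
    have htC : t ∈ C := by
      rw [hCdef, Submodule.mem_comap, hfapp]
      exact hkt
    exact ⟨mem_sup.2 ⟨q, hq, t, htC, rfl⟩, hbT⟩
  · -- `k · NK ⊆ L ∩ S_{j+1}`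
    obtain ⟨hxU, hxT⟩ := hx
    obtain ⟨q, hq, t, ht, rfl⟩ := mem_sup.1 hxU
    rw [hCdef, Submodule.mem_comap, hfapp, ← hLK] at ht
    refine ⟨?_, Ts.smul_mem _ hxT⟩
    rw [smul_add]
    exact add_mem (hΛL (hk q hq)) ht.1

/-- **THEOREM 6.5, STEPS 2–3 assembled (finiteness of the set (6.3))** — for a surjective ring homomorphism
`π : A → B` with nilpotent kernel `R`, a full lattice `Λ` and a finitely generated `K ⊆ B`: **the exact `Λ`-ideals
`L ⊇ Λ` with `π(L) = K` form a FINITE set** («we will show for each `i ∈ I` that the set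
`{L | L ∈ 𝓛(A) with 𝒪(L) = Λ, L^{[0]} = K^i, L ⊃ Λ}` is finite. […] The set in (6.5) is finite for any `m`,
especially for `m = n_max + 1`», where `S_{n_max+1} = A`). [cite: HertlingLarabi2026, §6 proof of Thm. 6.5, Steps 2–3, (6.3), (6.5), chunks p0016–p0017] -/
theorem finite_setOf_div_self_eq_and_le_and_map_eq {π : A →+* B} (hπ : Surjective π)
    (hnil : IsNilpotent (RingHom.ker π)) {Λ : Submodule ℤ A} (hΛ : IsFullLattice A Λ)
    {K : Submodule ℤ B} (hK : K.FG) :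
    {L : Submodule ℤ A | IsFullLattice A L ∧ L / L = Λ ∧ Λ ≤ L ∧
      L.map (π : A →+ B).toIntLinearMap = K}.Finite := by
  set S : Set (Submodule ℤ A) := {L : Submodule ℤ A | IsFullLattice A L ∧ L / L = Λ ∧ Λ ≤ L ∧
      L.map (π : A →+ B).toIntLinearMap = K}
  have hS : ∀ L ∈ S, L.FG ∧ Λ ≤ L ∧ Λ * L ≤ L := by
    rintro L ⟨hL, hO, hΛL, -⟩
    refine ⟨hL.1, hΛL, mul_le.2 fun a ha b hb => ?_⟩
    rw [← hO] at ha
    exact (mem_div_iff_forall_mul_mem.1 ha) b hb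
  -- induction on the socle filtration, from `j = 1`
  have hind : ∀ j : ℕ, 1 ≤ j → {M : Submodule ℤ A | ∃ L ∈ S,
      M = L ⊓ ((RingHom.ker π ^ j).annihilator).restrictScalars ℤ}.Finite := by
    intro j hj
    induction j, hj using Nat.le_induction with
    | base =>
      refine (finite_setOf_inf_annihilator_ker hπ hΛ hK).subset ?_
      rintro M ⟨L, ⟨-, hO, hΛL, hLK⟩, rfl⟩
      exact ⟨L, ⟨hO, hΛL, hLK⟩, by rw [pow_one]⟩
    | succ j hj ih => exact finite_setOf_inf_annihilator_pow_succ π hΛ hS hj ih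
  -- `S_{n+1} = A` for `R^n = 0`
  obtain ⟨n, hn⟩ := hnil
  have htop : ((RingHom.ker π ^ (n + 1)).annihilator).restrictScalars ℤ = (⊤ : Submodule ℤ A) := by
    rw [annihilator_pow_eq_top_of_pow_eq_bot ((pow_eq_zero_of_le (Nat.le_succ n) hn).trans
      Submodule.zero_eq_bot), Submodule.restrictScalars_top]
  refine (hind (n + 1) (Nat.succ_le_succ (Nat.zero_le n))).subset fun L hL => ⟨L, hL, ?_⟩
  rw [htop, inf_top_eq]

end StepThree

/-! ## §4 Step 1 and Theorem 6.5 -/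

section StepOne

variable {A B : Type} [CommRing A] [CommRing B] [Algebra ℚ A]

omit [Algebra ℚ A] in
/-- A nilpotent kernel consists of nilpotent elements. [folklore] -/
private theorem isNilpotent_of_map_eq_zero {π : A →+* B} (hnil : IsNilpotent (RingHom.ker π)) {x : A}
    (hx : π x = 0) : IsNilpotent x := by
  obtain ⟨n, hn⟩ := hnil
  refine ⟨n, ?_⟩
  have h : x ^ n ∈ RingHom.ker π ^ n := Ideal.pow_mem_pow ((RingHom.mem_ker).2 hx) n
  rw [hn, Submodule.zero_eq_bot, Ideal.mem_bot] at h
  exact h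

/-- Every `ε`-class of full lattices of `B` has a member containing `1` (for `π : A → B` from a `ℚ`-algebra: a
nonzero integer `z ∈ M` is a unit, «We can choose it and will choose it such that `1_A ∈ K^i`»).
[cite: HertlingLarabi2026, §6 proof of Thm. 6.5, Step 1, chunk p0016] -/
theorem exists_units_smul_one_mem (π : A →+* B) {M : Submodule ℤ B} (hM : IsFullLattice B M) :
    ∃ v : Bˣ, (1 : B) ∈ v • M := by
  obtain ⟨z, hz0, hz⟩ := hM.2 1
  have hzu : IsUnit (algebraMap ℚ A z) := (IsUnit.mk0 (z : ℚ) (by exact_mod_cast hz0)).map (algebraMap ℚ A)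
  rw [map_intCast] at hzu
  refine ⟨(Units.map (π : A →* B) hzu.unit)⁻¹, ?_⟩
  rw [mem_units_smul_submodule_iff, inv_inv, Units.smul_def, smul_eq_mul, mul_one]
  have e : ((Units.map (π : A →* B) hzu.unit : Bˣ) : B) = z • (1 : B) := by
    simp [zsmul_eq_mul]
  rw [e]
  exact hz

omit [Algebra ℚ A] in
/-- **THEOREM 6.5, STEP 1 (normalising inside an `ε`-class)** — for a surjective `π : A → B` with nilpotent
kernel and a full lattice `K ∋ 1` of `B`: every exact `Λ`-ideal `L` whose projection is `ε`-equivalent to `K`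
is `ε`-equivalent to an exact `Λ`-ideal `L̃ ⊇ Λ` with `π(L̃) = K` («If `1_A ∉ L` for such an `L`, then `1_A + r ∈ L`
for some `r ∈ R`, because `L^{[0]} = K^i` and `1_A ∈ K^i`. Then we replace `L` by `L̃ := (1_A + r)⁻¹L`. It satisfies
`[L̃]_ε = [L]_ε`, `L̃^{[0]} = L^{[0]} = K^i` and `1_A ∈ L̃`. Finally, for an exact `Λ`-ideal `L` the condition
`1_A ∈ L` is equivalent to the condition `L ⊃ Λ`»; units of `B` lift to units of `A`, Rem. 3.2 (iii)).
[cite: HertlingLarabi2026, §6 proof of Thm. 6.5, Step 1, chunk p0016] -/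
theorem exists_units_smul_le_and_map_eq {π : A →+* B} (hπ : Surjective π) (hnil : IsNilpotent (RingHom.ker π))
    {Λ L : Submodule ℤ A} (hL : IsFullLattice A L) (hO : L / L = Λ)
    {K : Submodule ℤ B} (h1K : (1 : B) ∈ K)
    {u : Bˣ} (hu : u • L.map (π : A →+ B).toIntLinearMap = K) :
    ∃ w : Aˣ, IsFullLattice A (w • L) ∧ (w • L) / (w • L) = Λ ∧ Λ ≤ w • L ∧
      (w • L).map (π : A →+ B).toIntLinearMap = K := by
  have hnil' : ∀ x, π x = 0 → IsNilpotent x := fun x hx => isNilpotent_of_map_eq_zero hnil hx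
  obtain ⟨w₁, hw₁⟩ := exists_units_map_eq_of_forall_isNilpotent hπ hnil' u
  have hL₁ : (w₁ • L).map (π : A →+ B).toIntLinearMap = K := by
    rw [map_units_smul, hw₁, hu]
  -- `1 ∈ K = π(w₁L)`: pick `a ∈ w₁L` with `π a = 1`; `a` is a unit
  obtain ⟨a, ha, hπa⟩ : ∃ a ∈ w₁ • L, π a = 1 := by
    rw [← hL₁] at h1K
    obtain ⟨a, ha, e⟩ := Submodule.mem_map.1 h1K
    exact ⟨a, ha, by simpa using e⟩
  have hau : IsUnit a := isUnit_of_isUnit_map_of_forall_isNilpotent hπ hnil' (by rw [hπa]; exact isUnit_one)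
  have hmap1 : Units.map (π : A →* B) hau.unit = 1 := Units.ext (by simpa using hπa)
  refine ⟨hau.unit⁻¹ * w₁, ?_, ?_, ?_, ?_⟩
  · rw [mul_smul]
    exact (hL.units_smul w₁).units_smul _
  · rw [mul_smul, div_self_units_smul, div_self_units_smul, hO]
  · have h1 : (1 : A) ∈ (hau.unit⁻¹ * w₁) • L := by
      rw [mul_smul, mem_units_smul_submodule_iff, inv_inv]
      have e : hau.unit • (1 : A) = a := by
        rw [Units.smul_def, IsUnit.unit_spec, smul_eq_mul, mul_one]
      rw [e]
      exact ha
    intro x hx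
    have hx' : x ∈ ((hau.unit⁻¹ * w₁) • L) / ((hau.unit⁻¹ * w₁) • L) := by
      rw [mul_smul, div_self_units_smul, div_self_units_smul, hO]
      exact hx
    simpa using (mem_div_iff_forall_mul_mem.1 hx') 1 h1
  · rw [mul_smul, map_units_smul, map_inv, hmap1, inv_one, one_smul, hL₁]

/-- **THEOREM 6.5, STEP 1 (reduction to the separable quotient)** — for a surjective ring homomorphism
`π : A → B` with nilpotent kernel and a full lattice `Λ ⊆ A`: **if the `ε`-classes of full `π(Λ)`-ideals of `B`
are finite, then the `ε`-classes of exact `Λ`-ideals `{[L]_ε | 𝒪(L) = Λ}` are finite** («An `ε`-class of full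
lattices in `A` projects by `L ↦ L^{[0]}` to an `ε`-class of full lattices in `F`. By the Jordan-Zassenhaus theorem
6.3 the set of `ε`-classes of `Λ^{[0]}`-ideals in `F` is finite, so it can be indexed by a finite set `I`. We choose
for each `i ∈ I` a representative `K^i ∈ 𝓛(F)` [with] `1_A ∈ K^i`. Each `ε`-class of exact `Λ`-ideals contains full
lattices `L` with `L^{[0]} = K^i` for some `i ∈ I`. […] Therefore it is sufficient to show for each `i ∈ I` that
the set (6.2) is finite»). [cite: HertlingLarabi2026, §6 proof of Thm. 6.5, Step 1, (6.2)–(6.3), chunk p0016] -/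
theorem finite_quot_div_self_eq_of_finite_quot_map {π : A →+* B} (hπ : Surjective π)
    (hnil : IsNilpotent (RingHom.ker π)) {Λ : Submodule ℤ A} (hΛ : IsFullLattice A Λ)
    (hfin : Finite (Quot fun M M' : {M : Submodule ℤ B // IsFullLattice B M ∧
        ∀ m ∈ M, ∀ a ∈ Λ.map (π : A →+ B).toIntLinearMap, m * a ∈ M} => ∃ u : Bˣ, u • M.1 = M'.1)) :
    Finite (Quot fun L L' : {L : Submodule ℤ A // IsFullLattice A L ∧ L / L = Λ} =>
      ∃ u : Aˣ, u • L.1 = L'.1) := by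
  classical
  -- representatives `K_c ∋ 1` of the classes `c` downstairs
  have hrep : ∀ c : Quot fun M M' : {M : Submodule ℤ B // IsFullLattice B M ∧
      ∀ m ∈ M, ∀ a ∈ Λ.map (π : A →+ B).toIntLinearMap, m * a ∈ M} => ∃ u : Bˣ, u • M.1 = M'.1,
      ∃ K : Submodule ℤ B, K.FG ∧ (1 : B) ∈ K ∧ ∃ v : Bˣ, v • (Quot.out c).1 = K := fun c => by
    obtain ⟨v, hv⟩ := exists_units_smul_one_mem π (Quot.out c).2.1
    exact ⟨v • (Quot.out c).1, ((Quot.out c).2.1.units_smul v).1, hv, v, rfl⟩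
  choose Kc hKfg hK1 v hv using hrep
  -- the finite sets (6.3)
  let SK := fun c => {L : Submodule ℤ A | IsFullLattice A L ∧ L / L = Λ ∧ Λ ≤ L ∧
      L.map (π : A →+ B).toIntLinearMap = Kc c}
  haveI hSfin : ∀ c, Finite (SK c) := fun c =>
    (finite_setOf_div_self_eq_and_le_and_map_eq hπ hnil hΛ (hKfg c)).to_subtype
  let Φ : (Σ c, SK c) →
      Quot fun L L' : {L : Submodule ℤ A // IsFullLattice A L ∧ L / L = Λ} => ∃ u : Aˣ, u • L.1 = L'.1 :=
    fun x => Quot.mk _ ⟨x.2.1, x.2.2.1, x.2.2.2.1⟩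
  refine Finite.of_surjective Φ ?_
  rintro ⟨⟨L, hL, hO⟩⟩
  -- `πL` is a full `πΛ`-ideal; its class `c`
  have hPL : IsFullLattice B (L.map (π : A →+ B).toIntLinearMap) ∧
      ∀ m ∈ L.map (π : A →+ B).toIntLinearMap, ∀ a ∈ Λ.map (π : A →+ B).toIntLinearMap,
        m * a ∈ L.map (π : A →+ B).toIntLinearMap := by
    refine ⟨isFullLattice_map_of_surjective hπ hL, fun m hm a ha => ?_⟩
    have h : L * Λ ≤ L := mul_le.2 fun l hl b hb => by
      rw [← hO] at hb
      rw [mul_comm]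
      exact (mem_div_iff_forall_mul_mem.1 hb) l hl
    exact map_mono h (by rw [map_mul_eq_map_mul_map]; exact mul_mem_mul hm ha)
  set c := Quot.mk (fun M M' : {M : Submodule ℤ B // IsFullLattice B M ∧
      ∀ m ∈ M, ∀ a ∈ Λ.map (π : A →+ B).toIntLinearMap, m * a ∈ M} => ∃ u : Bˣ, u • M.1 = M'.1)
    ⟨_, hPL⟩
  -- `u • πL = K_c` for a unit `u`
  obtain ⟨u₀, hu₀⟩ : ∃ u₀ : Bˣ, u₀ • (Quot.out c).1 = L.map (π : A →+ B).toIntLinearMap :=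
    (equivalence_exists_units_smul _).eqvGen_iff.1 (Quot.eqvGen_exact (Quot.out_eq c))
  have hu : (v c * u₀⁻¹) • L.map (π : A →+ B).toIntLinearMap = Kc c := by
    rw [mul_smul, ← hu₀, inv_smul_smul, hv]
  obtain ⟨w, hwL, hwO, hwΛ, hwK⟩ := exists_units_smul_le_and_map_eq hπ hnil hL hO (hK1 c) hu
  refine ⟨⟨c, ⟨w • L, hwL, hwO, hwΛ, hwK⟩⟩, ?_⟩
  exact (Quot.sound ⟨w, rfl⟩).symm

/-- **THEOREM 6.5 (Hertling–Larabi 2026, «an extension of the Jordan-Zassenhaus theorem»; for `R² = 0` Faddeev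
[Fa67]).** «Let `A` be as in Theorem 3.1, so `A` is a finite dimensional commutative `ℚ`-algebra with unit element.
For any order `Λ` in `A`, the set `{[L]_ε | L ∈ 𝓛(A), 𝒪(L) = Λ}` of `ε`-classes of exact `Λ`-ideals is finite.»
Here `Λ` may be any full lattice (for a non-order the set is empty), `𝒪(L) = Λ` is `L / L = Λ`, and the set of
`ε`-classes is the quotient type by `L ∼ uL`, `u ∈ A^{unit}`.  Proof as printed, Steps 1–3: `pr_F` is
`A → A/nilradical(A)` (reduced, finite-dimensional; its kernel is nilpotent since `A` is artinian), Step 1 uses the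
Jordan–Zassenhaus theorem 6.3 downstairs (`FiniteQAlgebraLatticeClassesFinite.finite_quot_isFullLattice_of_isReduced`),
Steps 2–3 climb the socle filtration `Ann(R^j)`. [cite: HertlingLarabi2026, §6 Thm. 6.5 and its proof, chunks p0015–p0017] -/
theorem finite_quot_div_self_eq [Module.Finite ℚ A] {Λ : Submodule ℤ A} (hΛ : IsFullLattice A Λ) :
    Finite (Quot fun L L' : {L : Submodule ℤ A // IsFullLattice A L ∧ L / L = Λ} =>
      ∃ u : Aˣ, u • L.1 = L'.1) := by
  haveI : IsReduced (A ⧸ nilradical A) :=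
    (Ideal.isRadical_iff_quotient_reduced _).1 (Ideal.radical_isRadical _)
  haveI : Module.Finite ℚ (A ⧸ nilradical A) :=
    Module.Finite.of_surjective (Ideal.Quotient.mkₐ ℚ (nilradical A)).toLinearMap
      (Ideal.Quotient.mkₐ_surjective ℚ _)
  haveI : IsArtinianRing A := IsArtinianRing.of_finite ℚ A
  have hnil : IsNilpotent (RingHom.ker (Ideal.Quotient.mk (nilradical A))) := by
    rw [Ideal.mk_ker]
    exact IsArtinianRing.isNilpotent_nilradical
  exact finite_quot_div_self_eq_of_finite_quot_map (π := Ideal.Quotient.mk (nilradical A))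
    Ideal.Quotient.mk_surjective hnil hΛ
    (finite_quot_isFullLattice_of_isReduced _
      (isFullLattice_map_of_surjective Ideal.Quotient.mk_surjective hΛ))

/-- **THEOREM 6.5 as a finite system of representatives**: for every finite-dimensional commutative `ℚ`-algebra
`A` and every full lattice `Λ` there is a finite set `T` of lattices such that every full lattice `L` with
`𝒪(L) = Λ` satisfies `uL ∈ T` for some unit `u`. [cite: HertlingLarabi2026, §6 Thm. 6.5, chunk p0015] -/
theorem exists_finset_forall_div_self_eq_exists_units_smul_mem [Module.Finite ℚ A] {Λ : Submodule ℤ A}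
    (hΛ : IsFullLattice A Λ) :
    ∃ T : Finset (Submodule ℤ A), ∀ L : Submodule ℤ A, IsFullLattice A L → L / L = Λ →
      ∃ u : Aˣ, u • L ∈ T := by
  classical
  haveI := finite_quot_div_self_eq hΛ
  letI := Fintype.ofFinite (Quot fun L L' : {L : Submodule ℤ A // IsFullLattice A L ∧ L / L = Λ} =>
    ∃ u : Aˣ, u • L.1 = L'.1)
  refine ⟨Finset.univ.image fun q : Quot (fun L L' : {L : Submodule ℤ A // IsFullLattice A L ∧ L / L = Λ} =>
      ∃ u : Aˣ, u • L.1 = L'.1) => (Quot.out q).1, fun L hL hO => ?_⟩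
  have e := Quot.out_eq (Quot.mk (fun L L' : {L : Submodule ℤ A // IsFullLattice A L ∧ L / L = Λ} =>
      ∃ u : Aˣ, u • L.1 = L'.1) ⟨L, hL, hO⟩)
  obtain ⟨u, hu⟩ := (equivalence_exists_units_smul _).eqvGen_iff.1 (Quot.eqvGen_exact e)
  exact ⟨u⁻¹, Finset.mem_image.2 ⟨Quot.mk _ ⟨L, hL, hO⟩, Finset.mem_univ _, eq_inv_smul_iff.2 hu⟩⟩

/-- **THEOREM 6.5 with Theorem 6.4 — exact versus all `Λ`-ideals**: for a NON-separable `A` and an order `Λ`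
the `ε`-classes of the exact `Λ`-ideals are finite (Thm. 6.5) although the `ε`-classes of all `Λ`-ideals
`{[L]_ε | 𝒪(L) ⊇ Λ}` are infinite (Thm. 6.4, `infinite_quot_isFullLattice_of_not_isReduced`) — «But if one
restricts to exact `Λ`-ideals, Theorem 6.3 generalizes to not separable algebras.»
[cite: HertlingLarabi2026, §6 Thm. 6.4 and the paragraph before Thm. 6.5, chunk p0015] -/
theorem finite_quot_div_self_eq_and_infinite_quot_of_not_isReduced [Module.Finite ℚ A] (hA : ¬IsReduced A)
    {Λ : Submodule ℤ A} (hΛ : IsFullLattice A Λ) (h1 : (1 : A) ∈ Λ) (hΛΛ : Λ * Λ ≤ Λ) :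
    Finite (Quot fun L L' : {L : Submodule ℤ A // IsFullLattice A L ∧ L / L = Λ} =>
        ∃ u : Aˣ, u • L.1 = L'.1) ∧
      Infinite (Quot fun M M' : {M : Submodule ℤ A // IsFullLattice A M ∧ ∀ m ∈ M, ∀ a ∈ Λ, m * a ∈ M} =>
        ∃ u : Aˣ, u • M.1 = M'.1) :=
  ⟨finite_quot_div_self_eq hΛ, infinite_quot_isFullLattice_of_not_isReduced hA hΛ h1 hΛΛ⟩

end StepOne

end Literature.NumberTheory.ComplexMultiplication.FiniteQAlgebraLattice
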